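import Mathlib
import HarnessLib
import Literature.Analysis.FluidPDE.ClassicalSolution
import Literature.Analysis.FluidPDE.AxisymmetricEuler
import Literature.Analysis.FluidPDE.GavrilovSteadyEuler
import Summits.NavierStokesRegularity.NavierStokesRegularity.Theses.AdiabaticEddy

/-!
# Crux FrozenEddyCollapse (stmt-NavierStokesRegularity-1430) — ideator 1, round 1: typed first lemmas

* `CorrectorEq U W q a b c f` — the route's corrector equation (★) of `CorrectorSolvable`
  (stmt-1429) DRESSED with an extra body force `f` (for `f = 0` it is literally (★)).
* `AxisymSwirlTorqueBound`, `AxisymNoSwirlBound`, `AxisymCorrectorNoGo` — the FIRST-ORDER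
  NO-GO for axisymmetric profiles found this session (NOTES.md §B1; Negative-notes): for an
  axisymmetric compactly supported steady Euler `U ≠ 0`, (★) forces `a + b ≤ 0` (swirl) resp.
  `a ≤ 2b` (no swirl), hence never `b < 0 < a + b` (collapse with Type-II amplitude).
  `noGo_of_bounds` (proved) assembles them; `correctorSolvable_profile_not_axisymmetric` (proved)
  shows the no-go bites the route decl `AdiabaticEddy.CorrectorSolvable` by name: any witness of
  it has a NON-axisymmetric profile.
* `DressedTorqueIdentity` — first lemma of card `reynolds-dressed-torque`: the `L^r`-moment
  identity behind the no-go, with the fluctuation torque `swirl f` on the right.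
* `NonAxisymCompactEddyExists` — first lemma of card `symmetry-broken-eddy`: a compactly
  supported smooth steady Euler flow with connected support and NO axis of symmetry.
-/

noncomputable section

namespace Summit.NavierStokesRegularity.NavierStokesRegularity.Cruxes.FrozenEddyCollapse.Ideator1

open scoped Topology
open MeasureTheory Set Filter
open Literature.Analysis.FluidPDE

local notation "E3" => EuclideanSpace ℝ (Fin 3)

/-- A smooth compactly supported steady Euler flow on `ℝ³` with pressure `P`
(route vocabulary of `CorrectorSolvable` / `FrozenEddyCollapse`). -/
def IsCompactSteadyEuler (U : E3 → E3) (P : E3 → ℝ) : Prop :=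
  ContDiff ℝ (⊤ : ℕ∞) U ∧ ContDiff ℝ (⊤ : ℕ∞) P ∧ HasCompactSupport U ∧
    VectorCalculus.IsDivFree U ∧ ∀ x, convect U U x + gradient P x = 0

/-- The corrector equation (★) of route AdiabaticEddy (crux `CorrectorSolvable`), dressed with an
extra body force `f` (Reynolds-stress divergence of a fluctuation field); `f = 0` is (★):
`U·∇W + W·∇U + ∇q = ΔU − aU + b(y·∇)U + (c·∇)U + f`. -/
def CorrectorEq (U W : E3 → E3) (q : E3 → ℝ) (a b : ℝ) (c : E3) (f : E3 → E3) : Prop :=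
  ∀ y, convect U W y + convect W U y + gradient q y =
    Laplacian.laplacian U y - a • U y + b • (fderiv ℝ U y) y + (fderiv ℝ U y) c + f y

/-- NO-GO, swirl case (NOTES §B1, identity (I_Γ) with `Φ = |s|^q`, `q → ∞`): for an axisymmetric
compactly supported steady Euler flow WITH swirl, solvability of (★) forces `a + b ≤ 0`
(the `L^q`-moment form of the maximum principle for `Γ = r u_θ = swirl U`: `AL` cannot grow). -/
def AxisymSwirlTorqueBound : Prop :=
  ∀ (U W : E3 → E3) (P q : E3 → ℝ) (a b : ℝ) (c : E3),
    IsCompactSteadyEuler U P → IsAxisymmetric U → ¬ HasNoSwirl U →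
    ContDiff ℝ (⊤ : ℕ∞) W → ContDiff ℝ (⊤ : ℕ∞) q → VectorCalculus.IsDivFree W →
    CorrectorEq U W q a b c 0 → a + b ≤ 0

/-- NO-GO, swirl-free case (NOTES §B1, identity (I_F) for `ω_θ/r`): for a nonzero axisymmetric
swirl-free compactly supported steady Euler flow, solvability of (★) forces `a ≤ 2b`
(`sup |ω_θ/r| ∝ A/L²` cannot grow). -/
def AxisymNoSwirlBound : Prop :=
  ∀ (U W : E3 → E3) (P q : E3 → ℝ) (a b : ℝ) (c : E3),
    IsCompactSteadyEuler U P → IsAxisymmetric U → HasNoSwirl U → U ≠ 0 →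
    ContDiff ℝ (⊤ : ℕ∞) W → ContDiff ℝ (⊤ : ℕ∞) q → VectorCalculus.IsDivFree W →
    CorrectorEq U W q a b c 0 → a ≤ 2 * b

/-- FIRST-ORDER NO-GO FOR AXISYMMETRIC PROFILES: an axisymmetric (about the `x₂`-axis; any other
axis reduces to this one by a translation `c ↦ c + b • y₀` and a rotation) nonzero compactly
supported steady Euler flow admits no corrector with `b < 0 < a + b`, i.e. it is never the frozen
profile of a Leray-length collapse with Type-II amplitude at first order in `Re⁻¹`. -/
def AxisymCorrectorNoGo : Prop :=
  ∀ (U W : E3 → E3) (P q : E3 → ℝ) (a b : ℝ) (c : E3),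
    IsCompactSteadyEuler U P → IsAxisymmetric U → U ≠ 0 →
    ContDiff ℝ (⊤ : ℕ∞) W → ContDiff ℝ (⊤ : ℕ∞) q → VectorCalculus.IsDivFree W →
    CorrectorEq U W q a b c 0 → ¬ (b < 0 ∧ 0 < a + b)

/-- The two moment bounds give the no-go (pure bookkeeping, checked). -/
theorem noGo_of_bounds (h₁ : AxisymSwirlTorqueBound) (h₂ : AxisymNoSwirlBound) :
    AxisymCorrectorNoGo := by
  intro U W P q a b c hE hax hU0 hW hq hdW hcorr hab
  obtain ⟨hb, hab⟩ := hab
  by_cases hsw : HasNoSwirl U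
  · have h := h₂ U W P q a b c hE hax hsw hU0 hW hq hdW hcorr
    linarith
  · have h := h₁ U W P q a b c hE hax hsw hW hq hdW hcorr
    linarith

/-- The no-go bites the route decl BY NAME: every witness of `AdiabaticEddy.CorrectorSolvable`
has a profile `U` that is NOT axisymmetric about the `x₂`-axis (and, applying the statement in
rotated/translated coordinates, about no axis at all). Checked reduction. -/
theorem correctorSolvable_profile_not_axisymmetric (hNG : AxisymCorrectorNoGo)
    (h : Summit.NavierStokesRegularity.NavierStokesRegularity.Theses.AdiabaticEddy.CorrectorSolvable) :
    ∃ (U W : E3 → E3) (P q : E3 → ℝ) (a b : ℝ) (c : E3),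
      IsCompactSteadyEuler U P ∧ U ≠ 0 ∧ ¬ IsAxisymmetric U ∧
      ContDiff ℝ (⊤ : ℕ∞) W ∧ ContDiff ℝ (⊤ : ℕ∞) q ∧ VectorCalculus.IsDivFree W ∧
      b < 0 ∧ 0 < a + b ∧ CorrectorEq U W q a b c 0 := by
  obtain ⟨U, W, P, q, a, b, c, hU, hP, hUc, hU0, hdiv, hEul, hW, hq, hdW, hb, hab, hcorr⟩ := h
  have hcorr' : CorrectorEq U W q a b c 0 := by
    intro y
    simp only [Pi.zero_apply, add_zero]
    exact hcorr y
  refine ⟨U, W, P, q, a, b, c, ⟨hU, hP, hUc, hdiv, hEul⟩, hU0, ?_, hW, hq, hdW, hb, hab, hcorr'⟩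
  intro hax
  exact hNG U W P q a b c ⟨hU, hP, hUc, hdiv, hEul⟩ hax hU0 hW hq hdW hcorr' ⟨hb, hab⟩

/-- FIRST LEMMA of card `reynolds-dressed-torque` (NOTES §B1, identity (I_Γ,f)): for an
axisymmetric compactly supported steady Euler profile and ANY smooth corrector data solving the
dressed equation, the `L^r` moments of `Γ_U = swirl U` obey
`[(a+b) r + 3b] ∫|Γ_U|^r + r(r−1) ∫|Γ_U|^{r−2}|∇Γ_U|² = r ∫ |Γ_U|^{r−2} Γ_U · swirl f`
for every real `r ≥ 2`. With `f = 0` and `r → ∞` this is the no-go; with `f ≠ 0` it says a Type-II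
collapse (`a + b > 0`) needs a torque density `swirl f` positively correlated with `Γ_U|Γ_U|^{r−2}`
for all large `r` — an up-gradient angular-momentum flux converging at the maximum of `|Γ_U|` and
beating viscous diffusion there. -/
def DressedTorqueIdentity : Prop :=
  ∀ (U W : E3 → E3) (P q : E3 → ℝ) (a b : ℝ) (c : E3) (f : E3 → E3),
    IsCompactSteadyEuler U P → IsAxisymmetric U →
    ContDiff ℝ (⊤ : ℕ∞) W → ContDiff ℝ (⊤ : ℕ∞) q → VectorCalculus.IsDivFree W →
    ContDiff ℝ (⊤ : ℕ∞) f → CorrectorEq U W q a b c f →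
    ∀ r : ℝ, 2 ≤ r →
      ((a + b) * r + 3 * b) * (∫ y, |swirl U y| ^ r) +
          r * (r - 1) * (∫ y, |swirl U y| ^ (r - 2) * ‖gradient (swirl U) y‖ ^ 2) =
        r * ∫ y, |swirl U y| ^ (r - 2) * swirl U y * swirl f y

/-- FIRST LEMMA of card `symmetry-broken-eddy` (the supply the no-go makes necessary): a nonzero
smooth compactly supported steady Euler flow on `ℝ³` with (pre)connected support and NO axis of
symmetry — for every affine isometric change of coordinates the conjugated field fails to be
axisymmetric about the `x₂`-axis. (3-D analogue of the 2024 nonradial compactly supported planar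
steady flows of Enciso–Fernández–Ruiz–Sicbaldi; open.) -/
def NonAxisymCompactEddyExists : Prop :=
  ∃ (U : E3 → E3) (P : E3 → ℝ), IsCompactSteadyEuler U P ∧ U ≠ 0 ∧
    IsPreconnected (Function.support U) ∧
    ∀ (x₀ : E3) (R : E3 ≃ₗᵢ[ℝ] E3), ¬ IsAxisymmetric (fun y => R.symm (U (R y + x₀)))

/-- ANY-AXIS form of the no-go: if `U` is axisymmetric in SOME Cartesian frame (`y = R y' + x₀`), it still
admits no corrector with `b < 0 < a + b`. Reduces to `AxisymCorrectorNoGo` because (★) is covariant under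
affine isometries (the dilation term shifts the translation constant: `c ↦ R.symm (c + b • x₀)`-type
bookkeeping); stated separately so refuters can apply it to Gavrilov tori centred anywhere. -/
def AxisymCorrectorNoGoAnyAxis : Prop :=
  ∀ (U W : E3 → E3) (P q : E3 → ℝ) (a b : ℝ) (c : E3) (x₀ : E3) (R : E3 ≃ₗᵢ[ℝ] E3),
    IsCompactSteadyEuler U P → IsAxisymmetric (fun y => R.symm (U (R y + x₀))) → U ≠ 0 →
    ContDiff ℝ (⊤ : ℕ∞) W → ContDiff ℝ (⊤ : ℕ∞) q → VectorCalculus.IsDivFree W →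
    CorrectorEq U W q a b c 0 → ¬ (b < 0 ∧ 0 < a + b)

/-- Checked link to the supply statement: under the any-axis no-go, a witness of the route decl
`AdiabaticEddy.CorrectorSolvable` yields a nonzero compactly supported smooth steady Euler flow with
NO axis of symmetry in any frame (i.e. `NonAxisymCompactEddyExists` up to the preconnectedness clause). -/
theorem correctorSolvable_forces_nonaxisym_supply (hNG : AxisymCorrectorNoGoAnyAxis)
    (h : Summit.NavierStokesRegularity.NavierStokesRegularity.Theses.AdiabaticEddy.CorrectorSolvable) :
    ∃ (U : E3 → E3) (P : E3 → ℝ), IsCompactSteadyEuler U P ∧ U ≠ 0 ∧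
      ∀ (x₀ : E3) (R : E3 ≃ₗᵢ[ℝ] E3), ¬ IsAxisymmetric (fun y => R.symm (U (R y + x₀))) := by
  obtain ⟨U, W, P, q, a, b, c, hU, hP, hUc, hU0, hdiv, hEul, hW, hq, hdW, hb, hab, hcorr⟩ := h
  have hcorr' : CorrectorEq U W q a b c 0 := by
    intro y
    simp only [Pi.zero_apply, add_zero]
    exact hcorr y
  refine ⟨U, P, ⟨hU, hP, hUc, hdiv, hEul⟩, hU0, fun x₀ R hax => ?_⟩
  exact hNG U W P q a b c x₀ R ⟨hU, hP, hUc, hdiv, hEul⟩ hax hU0 hW hq hdW hcorr' ⟨hb, hab⟩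

/-- Sanity link: Gavrilov's flow (tree fact `gavrilov_compact_steady_euler`) is axisymmetric with
swirl, so by `AxisymSwirlTorqueBound` it can never carry a corrector with `a + b > 0`. -/
theorem gavrilov_not_typeII_profile (h₁ : AxisymSwirlTorqueBound)
    (hG : gavrilov_compact_steady_euler) :
    ∃ (U : E3 → E3) (P : E3 → ℝ), IsCompactSteadyEuler U P ∧ U ≠ 0 ∧ IsAxisymmetric U ∧
      ∀ (W : E3 → E3) (q : E3 → ℝ) (a b : ℝ) (c : E3),
        ContDiff ℝ (⊤ : ℕ∞) W → ContDiff ℝ (⊤ : ℕ∞) q → VectorCalculus.IsDivFree W →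
        CorrectorEq U W q a b c 0 → a + b ≤ 0 := by
  obtain ⟨U, P, hU, hP, hUc, -, hU0, -, hax, -, hsw, hdiv, hE, -⟩ := hG 1 one_pos 1 one_pos
  exact ⟨U, P, ⟨hU, hP, hUc, hdiv, hE⟩, hU0, hax,
    fun W q a b c hW hq hdW hcorr => h₁ U W P q a b c ⟨hU, hP, hUc, hdiv, hE⟩ hax hsw hW hq hdW hcorr⟩

end Summit.NavierStokesRegularity.NavierStokesRegularity.Cruxes.FrozenEddyCollapse.Ideator1
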